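import Summits.BirchSwinnertonDyer.BirchSwinnertonDyer.Theses.AdditiveBranchIMC
import Literature.NumberTheory.EllipticCurves.Pal2012.QuadraticTwistPeriodProofs
import HarnessLib

/-!
# Route `AdditiveBranchIMC`: the item `PalQuadraticTwistPeriod` CLOSED by name — its Literature constant is a tree THEOREM

Item stmt-BirchSwinnertonDyer-19587 (support) of route `AdditiveBranchIMC` is, by name, the Literature constant behind
`Summit.BirchSwinnertonDyer.BirchSwinnertonDyer.Theses.AdditiveBranchIMC.PalQuadraticTwistPeriod` (Pal 2012 Thm. 3.2: the real period of the quadratic twist by a prime `p ≡ 1 (mod 4)`). That named fact is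
DISCHARGED in the tree: `Literature.NumberTheory.EllipticCurves.Pal2012.thm32_sqrt_mul_realPeriodRat_twist_eq_of_prime_one_mod_four_holds`
(module `Literature.NumberTheory.EllipticCurves.Pal2012.QuadraticTwistPeriodProofs`). This file only restates that theorem at the FULLY-QUALIFIED item type, so the
ledger item closes `proved`; nothing is asserted, no hypothesis, no new declaration besides the
alias theorem.

Honest framing: closes ONE cite-only published-input item of a route of `BirchSwinnertonDyer` by
name; no crux; no label or count of any partition moves; BSD is proved for no curve by this file.
Prepared by cell `bsd-eis`, seat `bsd-eis-k5-ty` g14 (literature-prover / typer; BSD-wide scan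
«open item whose Literature constant already has a `_holds`»), for a PROVER of the owning cell to
file. [cite: Pal2012, Thm. 3.2 (p. 1519) with Prop. 2.5 (pp. 1516–1517)]
-/

set_option autoImplicit false
set_option linter.dupNamespace false

namespace Summit.BirchSwinnertonDyer.BirchSwinnertonDyer.Theorems

/-- **Item `AdditiveBranchIMC.PalQuadraticTwistPeriod` holds**, by the Literature theorem
`Literature.NumberTheory.EllipticCurves.Pal2012.thm32_sqrt_mul_realPeriodRat_twist_eq_of_prime_one_mod_four_holds`. [cite: Pal2012, Thm. 3.2 (p. 1519) with Prop. 2.5 (pp. 1516–1517)] -/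
theorem additiveBranchIMC_palQuadraticTwistPeriod_holds :
    Summit.BirchSwinnertonDyer.BirchSwinnertonDyer.Theses.AdditiveBranchIMC.PalQuadraticTwistPeriod :=
  Literature.NumberTheory.EllipticCurves.Pal2012.thm32_sqrt_mul_realPeriodRat_twist_eq_of_prime_one_mod_four_holds

end Summit.BirchSwinnertonDyer.BirchSwinnertonDyer.Theorems
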